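import Summits.CriticalPhenomena.PercolationContinuityZ3.Theorems.Transplant.FKConnectivityAllQPat3LevelsC
import Summits.CriticalPhenomena.PercolationContinuityZ3.Theorems.Transplant.FKConnectivityAllQPat3Gluing
import HarnessLib

/-!
# Connectivity correlation inequalities for `φ_{w,q}`, every `q > 0` — ADDING THE EDGE BETWEEN TWO MARKS (Stage S3/S4 groundwork,
# part 3): the minor-generator `T(A + uv)` is a table functional on `A`

Definitions + theorems file (`--supports stmt-CriticalPhenomena-4575`), census lane `prim-bschramm-census` (gen 36) of the post-continuity programme (LANE 2 bschramm, FK sub-lane);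
builds on p205010 (kernel theorem, internal audit signed; external expert review pending).
No named facts, no sorries; standard axioms.  Census g36 memo §30 (ii): THEOREM 3C's «minor-only generators» `T(A + uv)`,
`T(A / uv)` on a side `A` are pattern tables on `A` — inserting the edge between the first two marks sends the pattern through
`FK.Pat3.contractXY` (`FK.pat3_union_edge`, `FK.pat3_insert_edge`) and shifts the level by `1{¬R.xy}` on the member of the pair
that carries the edge (`FK.apExp_insert_edge_left/_right`, fk-2's `clusterCount_union_pair_add`); **`FK.lev2_insert_edge`** is the
resulting expansion of `lev2 (insert xy A)` over `A.powerset`; `FK.apExpC_contract_edge` / **`FK.lev2C_contract_edge`** the one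
of the CONTRACTED minor `A / xy` (`FK.lev2C` of `…Pat3LevelsC`, both members carry the edge).
[cite: Grimmett2006, §1.2 Thm. (3.1)(a); §1.4 eq. (1.20) (p. 15)]
-/

noncomputable section

namespace Summit.CriticalPhenomena.PercolationContinuityZ3.Theorems

namespace FK

open SimpleGraph Literature.Probability.LatticeModels Literature.Probability.Percolation
section EdgeMinor

open scoped Classical

variable {V : Type*} [Fintype V]

/-! ### Adding / contracting the edge between the first two marks (census g36 memo §30: minor-generators are tables) -/

/-- The pattern after joining the first two marks: `xy := true`, `xs, ys := xs ∨ ys`. [folklore] -/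
def Pat3.contractXY : Pat3 → Pat3
  | Pat3.sep => Pat3.xy_s
  | Pat3.xy_s => Pat3.xy_s
  | _ => Pat3.all

omit [Fintype V] in
/-- **Inserting the edge `xy` contracts the pattern**: for `γ` supported on `V_A ∋ x, y` and `s` a third vertex,
`pat3 (γ ∪ {xy}) x y s = (pat3 γ x y s).contractXY` (S1's parallel-gluing lemmas with the one-edge piece `{xy}`). [folklore] -/
theorem pat3_union_edge {A : Finset (Sym2 V)} {VA : Set V} (hA : ∀ e ∈ (↑A : Set (Sym2 V)), ∀ z ∈ e, z ∈ VA) {x y s : V}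
    (hxy : x ≠ y) (hsx : s ≠ x) (hsy : s ≠ y) {γ : Finset (Sym2 V)} (g : γ ⊆ A) :
    pat3 (γ ∪ {s(x, y)}) x y s = (pat3 γ x y s).contractXY := by
  -- the one-edge piece and its support
  have hB : ∀ e ∈ (↑({s(x, y)} : Finset (Sym2 V)) : Set (Sym2 V)), ∀ z ∈ e, z ∈ ({x, y} : Set V) := by
    intro e he z hz
    rw [Finset.coe_singleton, Set.mem_singleton_iff] at he
    subst he
    rcases Sym2.mem_iff.1 hz with h | h
    · exact Or.inl h
    · exact Or.inr h
  have hS : VA ∩ ({x, y} : Set V) ⊆ {x, y} := fun z hz => hz.2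
  have hsB : s ∉ ({x, y} : Set V) := fun h => h.elim hsx hsy
  have euv := reachable_union_parallel hA hB hS g (subset_refl _)
  have exs := reachable_union_par_third hB hA (fun z hz => hS ⟨hz.2, hz.1⟩) hsB hsx hsy (subset_refl _) g
  have eys := reachable_union_par_third (x := y) (y := x) hB hA
    (fun z hz => by rcases hS ⟨hz.2, hz.1⟩ with h | h <;> [exact Or.inr h; exact Or.inl h]) hsB hsy hsx (subset_refl _) g
  rw [Finset.union_comm] at exs eys
  have hedge : (openGraph (↑({s(x, y)} : Finset (Sym2 V)) : BondConfig V)).Reachable x y := by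
    refine SimpleGraph.Adj.reachable ((openGraph_adj _ x y).2 ⟨?_, hxy⟩)
    rw [Finset.coe_singleton]
    exact Set.mem_singleton _
  have b1 := pat3_xy_iff γ x y s
  have b2 := pat3_xs_iff γ x y s
  have b3 := pat3_ys_iff γ x y s
  apply pat3_eq_of_iff
  · rw [euv, show (pat3 γ x y s).contractXY.xy = true by cases pat3 γ x y s <;> rfl]
    exact ⟨fun _ => rfl, fun _ => Or.inr hedge⟩
  · rw [exs, show (pat3 γ x y s).contractXY.xs = ((pat3 γ x y s).xs || (pat3 γ x y s).ys) by cases pat3 γ x y s <;> rfl,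
      Bool.or_eq_true, b2, b3]
    constructor
    · rintro (h | ⟨_, h⟩)
      · exact Or.inl h
      · exact Or.inr h
    · rintro (h | h)
      · exact Or.inl h
      · exact Or.inr ⟨Or.inl hedge, h⟩
  · rw [eys, show (pat3 γ x y s).contractXY.ys = ((pat3 γ x y s).xs || (pat3 γ x y s).ys) by cases pat3 γ x y s <;> rfl,
      Bool.or_eq_true, b2, b3]
    constructor
    · rintro (h | ⟨_, h⟩)
      · exact Or.inr h
      · exact Or.inl h
    · rintro (h | h)
      · exact Or.inr ⟨Or.inl hedge.symm, h⟩
      · exact Or.inl h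

/-- The antipodal exponent after ADDING the edge `xy` to the network, for a configuration NOT containing it: the complement
member gains the edge and loses a cluster exactly when its pattern does not join `x, y`. [folklore] -/
theorem apExp_insert_edge_left {A γ : Finset (Sym2 V)} {x y : V} (s : V) (he : s(x, y) ∉ A) (g : γ ⊆ A) :
    apExp (insert s(x, y) A) γ + (if (pat3 (A \ γ) x y s).xy then 0 else 1) = apExp A γ := by
  have hγ : s(x, y) ∉ γ := fun h => he (g h)
  have e1 : insert s(x, y) A \ γ = insert s(x, y) (A \ γ) := by
    ext f
    simp only [Finset.mem_sdiff, Finset.mem_insert]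
    constructor
    · rintro ⟨h1 | h1, h2⟩
      · exact Or.inl h1
      · exact Or.inr ⟨h1, h2⟩
    · rintro (h1 | ⟨h1, h2⟩)
      · exact ⟨Or.inl h1, fun h => hγ (h1 ▸ h)⟩
      · exact ⟨Or.inr h1, h2⟩
  have k := clusterCount_union_pair_add (↑(A \ γ) : BondConfig V) x y
  rw [← Finset.coe_singleton, ← Finset.coe_union, Finset.union_comm, ← Finset.insert_eq] at k
  unfold apExp
  rw [e1]
  by_cases h : (openGraph (↑(A \ γ) : BondConfig V)).Reachable x y
  · rw [if_pos h] at k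
    rw [(pat3_xy_iff (A \ γ) x y s).2 h |> fun hh => show (if (pat3 (A \ γ) x y s).xy then 0 else 1) = 0 by rw [hh]; rfl]
    omega
  · rw [if_neg h] at k
    have hb : (pat3 (A \ γ) x y s).xy = false := by
      cases hc : (pat3 (A \ γ) x y s).xy
      · rfl
      · exact absurd ((pat3_xy_iff (A \ γ) x y s).1 hc) h
    rw [hb]
    simp only [Bool.false_eq_true, ↓reduceIte]
    omega

/-- The antipodal exponent after ADDING the edge `xy`, for the configuration CONTAINING it: the configuration member loses a
cluster exactly when its pattern without the edge does not join `x, y`. [folklore] -/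
theorem apExp_insert_edge_right {A γ : Finset (Sym2 V)} {x y : V} (s : V) (he : s(x, y) ∉ A) (g : γ ⊆ A) :
    apExp (insert s(x, y) A) (insert s(x, y) γ) + (if (pat3 γ x y s).xy then 0 else 1) = apExp A γ := by
  have hγ : s(x, y) ∉ γ := fun h => he (g h)
  have e1 : insert s(x, y) A \ insert s(x, y) γ = A \ γ := by
    ext f
    simp only [Finset.mem_sdiff, Finset.mem_insert, not_or]
    constructor
    · rintro ⟨h1 | h1, h2, h3⟩
      · exact absurd h1 h2
      · exact ⟨h1, h3⟩
    · rintro ⟨h1, h2⟩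
      exact ⟨Or.inr h1, fun h => he (h ▸ h1), h2⟩
  have k := clusterCount_union_pair_add (↑γ : BondConfig V) x y
  rw [← Finset.coe_singleton, ← Finset.coe_union, Finset.union_comm, ← Finset.insert_eq] at k
  unfold apExp
  rw [e1]
  by_cases h : (openGraph (↑γ : BondConfig V)).Reachable x y
  · rw [if_pos h] at k
    rw [(pat3_xy_iff γ x y s).2 h |> fun hh => show (if (pat3 γ x y s).xy then 0 else 1) = 0 by rw [hh]; rfl]
    omega
  · rw [if_neg h] at k
    have hb : (pat3 γ x y s).xy = false := by
      cases hc : (pat3 γ x y s).xy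
      · rfl
      · exact absurd ((pat3_xy_iff γ x y s).1 hc) h
    rw [hb]
    simp only [Bool.false_eq_true, ↓reduceIte]
    omega

omit [Fintype V] in
/-- `pat3` after inserting the edge between the first two marks (corollary of `FK.pat3_union_edge`). [folklore] -/
theorem pat3_insert_edge {A : Finset (Sym2 V)} {VA : Set V} (hA : ∀ e ∈ (↑A : Set (Sym2 V)), ∀ z ∈ e, z ∈ VA) {x y s : V}
    (hxy : x ≠ y) (hsx : s ≠ x) (hsy : s ≠ y) {γ : Finset (Sym2 V)} (g : γ ⊆ A) :
    pat3 (insert s(x, y) γ) x y s = (pat3 γ x y s).contractXY := by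
  rw [Finset.insert_eq, Finset.union_comm]
  exact pat3_union_edge hA hxy hsx hsy g

omit [Fintype V] in
/-- Set bookkeeping: removing a configuration without the new edge keeps the new edge. [folklore] -/
theorem insert_sdiff_of_not_mem {A γ : Finset (Sym2 V)} {e : Sym2 V} (hγ : e ∉ γ) :
    insert e A \ γ = insert e (A \ γ) := by
  ext f
  simp only [Finset.mem_sdiff, Finset.mem_insert]
  constructor
  · rintro ⟨h1 | h1, h2⟩
    · exact Or.inl h1
    · exact Or.inr ⟨h1, h2⟩
  · rintro (h1 | ⟨h1, h2⟩)
    · exact ⟨Or.inl h1, fun h => hγ (h1 ▸ h)⟩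
    · exact ⟨Or.inr h1, h2⟩

omit [Fintype V] in
/-- Set bookkeeping: the complement of a configuration containing the new edge. [folklore] -/
theorem insert_sdiff_insert_of_not_mem {A γ : Finset (Sym2 V)} {e : Sym2 V} (he : e ∉ A) :
    insert e A \ insert e γ = A \ γ := by
  ext f
  simp only [Finset.mem_sdiff, Finset.mem_insert, not_or]
  constructor
  · rintro ⟨h1 | h1, h2, h3⟩
    · exact absurd h1 h2
    · exact ⟨h1, h3⟩
  · rintro ⟨h1, h2⟩
    exact ⟨Or.inr h1, fun h => he (h ▸ h1), h2⟩

/-- **`lev2` OF THE GRAPH WITH THE EDGE `xy` ADDED, as a sum over the configurations of the graph WITHOUT it** (memo §30 (ii):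
the minor-generator `T(A + uv)` is a table functional on `A` — patterns through `contractXY`, levels shifted by
`δ(R) = 1{¬R.xy}` on the member that carries the new edge). [folklore] -/
theorem lev2_insert_edge {A : Finset (Sym2 V)} {VA : Set V} (hA : ∀ e ∈ (↑A : Set (Sym2 V)), ∀ z ∈ e, z ∈ VA) {x y s : V}
    (hxy : x ≠ y) (hsx : s ≠ x) (hsy : s ≠ y) (he : s(x, y) ∉ A) (F : ℕ → Pat3 → Pat3 → ℤ) (μ : ℕ) :
    lev2 (insert s(x, y) A) x y s F μ =
      ∑ γ ∈ A.powerset,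
        (((if apExp A γ = μ + (if (pat3 (A \ γ) x y s).xy then 0 else 1) then
              F 0 (pat3 γ x y s) (pat3 (A \ γ) x y s).contractXY else 0) +
            (if apExp A γ + 1 = μ + (if (pat3 (A \ γ) x y s).xy then 0 else 1) then
              F 1 (pat3 γ x y s) (pat3 (A \ γ) x y s).contractXY else 0)) +
          ((if apExp A γ = μ + (if (pat3 γ x y s).xy then 0 else 1) then
              F 0 (pat3 γ x y s).contractXY (pat3 (A \ γ) x y s) else 0) +
            (if apExp A γ + 1 = μ + (if (pat3 γ x y s).xy then 0 else 1) then
              F 1 (pat3 γ x y s).contractXY (pat3 (A \ γ) x y s) else 0))) := by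
  unfold lev2
  have hdisj : Disjoint A.powerset (A.powerset.image (insert s(x, y))) := by
    rw [Finset.disjoint_left]
    intro γ hγ hγ'
    rw [Finset.mem_image] at hγ'
    obtain ⟨γ', _, hγ'⟩ := hγ'
    have : s(x, y) ∈ γ := hγ' ▸ Finset.mem_insert_self _ _
    exact he (Finset.mem_powerset.1 hγ this)
  have hinj : Set.InjOn (insert s(x, y)) (↑A.powerset : Set (Finset (Sym2 V))) := by
    intro γ₁ h₁ γ₂ h₂ h
    have e1 : s(x, y) ∉ γ₁ := fun hh => he (Finset.mem_powerset.1 (Finset.mem_coe.1 h₁) hh)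
    have e2 : s(x, y) ∉ γ₂ := fun hh => he (Finset.mem_powerset.1 (Finset.mem_coe.1 h₂) hh)
    rw [← Finset.erase_insert e1, ← Finset.erase_insert e2, h]
  rw [Finset.powerset_insert, Finset.sum_union hdisj, Finset.sum_image hinj, ← Finset.sum_add_distrib]
  refine Finset.sum_congr rfl fun γ hγ => ?_
  have g := Finset.mem_powerset.1 hγ
  have hγe : s(x, y) ∉ γ := fun hh => he (g hh)
  have kL := apExp_insert_edge_left s he g
  have kR := apExp_insert_edge_right s he g
  rw [insert_sdiff_of_not_mem hγe, insert_sdiff_insert_of_not_mem he,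
    pat3_insert_edge hA hxy hsx hsy (Finset.sdiff_subset.trans (subset_refl A)), pat3_insert_edge hA hxy hsx hsy g]
  have c1 : (apExp (insert s(x, y) A) γ = μ) ↔ (apExp A γ = μ + (if (pat3 (A \ γ) x y s).xy then 0 else 1)) := by omega
  have c2 : (apExp (insert s(x, y) A) γ + 1 = μ) ↔ (apExp A γ + 1 = μ + (if (pat3 (A \ γ) x y s).xy then 0 else 1)) := by
    omega
  have c3 : (apExp (insert s(x, y) A) (insert s(x, y) γ) = μ) ↔ (apExp A γ = μ + (if (pat3 γ x y s).xy then 0 else 1)) := by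
    omega
  have c4 : (apExp (insert s(x, y) A) (insert s(x, y) γ) + 1 = μ) ↔
      (apExp A γ + 1 = μ + (if (pat3 γ x y s).xy then 0 else 1)) := by omega
  simp only [c1, c2, c3, c4]

/-- The contracted exponent of the minor `A / xy` (contracted set `{xy}`, `xy ∉ A`): both members of the pair carry the edge,
so `apExpC A {xy} γ + 1{¬P.xy} + 1{¬Q.xy} = apExp A γ`. [folklore] -/
theorem apExpC_contract_edge (A γ : Finset (Sym2 V)) (x y s : V) :
    apExpC A {s(x, y)} γ + (if (pat3 γ x y s).xy then 0 else 1) + (if (pat3 (A \ γ) x y s).xy then 0 else 1) =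
      apExp A γ := by
  have k1 := clusterCount_union_pair_add (↑γ : BondConfig V) x y
  have k2 := clusterCount_union_pair_add (↑(A \ γ) : BondConfig V) x y
  rw [← Finset.coe_singleton, ← Finset.coe_union] at k1 k2
  unfold apExpC apExp
  by_cases h1 : (openGraph (↑γ : BondConfig V)).Reachable x y <;>
  by_cases h2 : (openGraph (↑(A \ γ) : BondConfig V)).Reachable x y
  all_goals
    first
    | (rw [if_pos h1] at k1) | (rw [if_neg h1] at k1)
  all_goals
    first
    | (rw [if_pos h2] at k2) | (rw [if_neg h2] at k2)
  all_goals
    have b1 : (pat3 γ x y s).xy = decide ((openGraph (↑γ : BondConfig V)).Reachable x y) := by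
      cases hc : (pat3 γ x y s).xy
      · rw [eq_comm, decide_eq_false_iff_not]; exact fun h => by rw [← pat3_xy_iff] at h; rw [hc] at h; exact Bool.false_ne_true h
      · rw [eq_comm, decide_eq_true_iff]; exact (pat3_xy_iff γ x y s).1 hc
    have b2 : (pat3 (A \ γ) x y s).xy = decide ((openGraph (↑(A \ γ) : BondConfig V)).Reachable x y) := by
      cases hc : (pat3 (A \ γ) x y s).xy
      · rw [eq_comm, decide_eq_false_iff_not]; exact fun h => by rw [← pat3_xy_iff] at h; rw [hc] at h; exact Bool.false_ne_true h
      · rw [eq_comm, decide_eq_true_iff]; exact (pat3_xy_iff (A \ γ) x y s).1 hc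
    simp only [b1, b2, h1, h2, decide_true, decide_false, Bool.false_eq_true, ↓reduceIte]
    omega

/-- **`lev2C` OF THE MINOR `A / xy` as a sum over the configurations of `A`** (memo §30 (ii): the minor-generator `T(A / uv)`
is a table functional on `A` — both patterns through `contractXY`, level shifted by `1{¬P.xy} + 1{¬Q.xy}`). [folklore] -/
theorem lev2C_contract_edge {A : Finset (Sym2 V)} {VA : Set V} (hA : ∀ e ∈ (↑A : Set (Sym2 V)), ∀ z ∈ e, z ∈ VA) {x y s : V}
    (hxy : x ≠ y) (hsx : s ≠ x) (hsy : s ≠ y) (F : ℕ → Pat3 → Pat3 → ℤ) (μ : ℕ) :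
    lev2C A {s(x, y)} x y s F μ =
      ∑ γ ∈ A.powerset,
        ((if apExp A γ = μ + (if (pat3 γ x y s).xy then 0 else 1) + (if (pat3 (A \ γ) x y s).xy then 0 else 1) then
            F 0 (pat3 γ x y s).contractXY (pat3 (A \ γ) x y s).contractXY else 0) +
          (if apExp A γ + 1 = μ + (if (pat3 γ x y s).xy then 0 else 1) + (if (pat3 (A \ γ) x y s).xy then 0 else 1) then
            F 1 (pat3 γ x y s).contractXY (pat3 (A \ γ) x y s).contractXY else 0)) := by
  unfold lev2C
  refine Finset.sum_congr rfl fun γ hγ => ?_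
  have g := Finset.mem_powerset.1 hγ
  have k := apExpC_contract_edge A γ x y s
  rw [pat3_union_edge hA hxy hsx hsy g, pat3_union_edge hA hxy hsx hsy (Finset.sdiff_subset (s := A) (t := γ))]
  have c1 : (apExpC A {s(x, y)} γ = μ) ↔
      (apExp A γ = μ + (if (pat3 γ x y s).xy then 0 else 1) + (if (pat3 (A \ γ) x y s).xy then 0 else 1)) := by omega
  have c2 : (apExpC A {s(x, y)} γ + 1 = μ) ↔
      (apExp A γ + 1 = μ + (if (pat3 γ x y s).xy then 0 else 1) + (if (pat3 (A \ γ) x y s).xy then 0 else 1)) := by omega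
  simp only [c1, c2]

end EdgeMinor

end FK

end Summit.CriticalPhenomena.PercolationContinuityZ3.Theorems

end
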